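import Mathlib
import Summits.ValiantsHypothesis.ValiantsHypothesis.Theorems.BarrierLeverPartitionMinorsHitByVPHiddenStatesBallCutPrep

/-!
# Route BarrierLever — item `PartitionMinorsHitByVP` (stmt-ValiantsHypothesis-19717), line `hidden-states`:
# THE EXACT COORDINATE CUT FOR THE BALL DESIGN, I — free coordinates: an m-th-shell family served on its support is served at every `h`

Helper file (`--supports stmt-ValiantsHypothesis-19717`; cell valiant-natproofs, 𝒟-side door (c), registered line
`Cruxes/PartitionMinorsHitByVP/Lines/hidden_states.lean` v9; prover seat val-np-p6 gen 21).  Closes NO item; definition-free.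

THE POINT (memo HOME/val-np-p6/g21/MEMO-valnp6-g21.md §1).  In the m-th-shell column (`𝒰 = B_t(h) ∖ {A_l} ∪ {C_l}`, columns the ball
`B_t(h)`, one cube of `K = h` states) a coordinate `x` outside every `A_l, C_l` is FREE, and cutting at it (the table reads `x` purely
through the state `x`: `tx none x = 0`, `tx (some q) x = [q = x]`) is an EXACT cut in the sense of `SymbJoin.symGood_of_split_enum`: the
rows avoiding `x` against the columns avoiding `x` are the same family one coordinate down, and the rows through `x` (with `x` erased)
against the columns through `x` are the ball `B_{t-1}` served by the zeta table (`BallCut.symGood_leaf_erase`).  Both blocks are square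
BECAUSE `x` is free (`BallCut.card_shellFamily`).  Consequences:
* `served_of_erase_free` / `served_of_subset_free` — servedness of the family on a coordinate set `S₀ ⊇ supp(A, C)` (every bijective
  enumeration generically good) propagates to every `S ⊇ S₀`;
* `served_image_of_served` — the standard `∀ u cols, … ∃ tx, det ≠ 0` statement on `Fin n` gives servedness on the image of any
  embedding `σ : Fin n ↪ Fin h` (renaming of coordinates AND states);
* ★ `exists_table_multiSwap_map_embedding` — THE FREE-COORDINATE THEOREM: if the m-swap family `(A, C)` is served on `Fin n` (standard
  form), then `(A.map σ, C.map σ)` is served on `Fin h` for every `σ : Fin n ↪ Fin h`.  So every «class (all h)» of the censuses (a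
  type-count vector on the support plus any number of free coordinates) is ONE finite instance at `h = |support|`: a kernel proof at the
  support size is a kernel proof of the class, for every `m` and `t`.
The sibling `…BallCutBalanced` does the same cut at a BALANCED coordinate (`#{l : x ∈ A_l} = #{l : x ∈ C_l}`), where the two blocks are
smaller shell families.

HONEST LABEL: conjecture-column toolkit (m-th shell of the ball, every `m, t, h`); 19717 stays OPEN; nothing on crux 14610 or VP ≠ VNP.
-/

set_option linter.dupNamespace false

namespace Summit.ValiantsHypothesis.ValiantsHypothesis.Theorems.BarrierLever.HiddenStates

open Finset

noncomputable section

namespace BallCut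

open SymbJoin

variable {h : ℕ}

/-! ## 1. The cut at a free coordinate -/

/-- **THE FREE-COORDINATE CUT.**  `x ∈ S` lies outside every `A_l, C_l ⊆ S`.  If every bijective enumeration of the m-th-shell family on
`S.erase x` against the ball `B_t(S.erase x)` is generically good, then so is every bijective enumeration of the family on `S` against
`B_t(S)`. -/
theorem served_of_erase_free (t : ℕ) {m : ℕ} (A C : Fin m → Finset (Fin h))
    (hA : ∀ l, (A l).card = t) (hC : ∀ l, (C l).card = t + 1)
    (hAi : Function.Injective A) (hCi : Function.Injective C)
    (S : Finset (Fin h)) (x : Fin h) (hAS : ∀ l, A l ⊆ S.erase x) (hCS : ∀ l, C l ⊆ S.erase x)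
    (IH : ∀ ⦃r : ℕ⦄ (u cols : Fin r → Finset (Fin h)), Function.Injective u → Function.Injective cols →
      (∀ U, (∃ i, u i = U) ↔ ((U ⊆ S.erase x ∧ U.card ≤ t ∧ ∀ l, U ≠ A l) ∨ ∃ l, U = C l)) →
      (∀ J, (∃ k, cols k = J) ↔ (J ⊆ S.erase x ∧ J.card ≤ t)) →
      symDet u (fun k => ((0 : Fin 1), cols k)) ≠ 0)
    {r : ℕ} (u cols : Fin r → Finset (Fin h)) (hu : Function.Injective u) (hcinj : Function.Injective cols)
    (hU : ∀ U, (∃ i, u i = U) ↔ ((U ⊆ S ∧ U.card ≤ t ∧ ∀ l, U ≠ A l) ∨ ∃ l, U = C l))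
    (hJ : ∀ J, (∃ k, cols k = J) ↔ (J ⊆ S ∧ J.card ≤ t)) :
    symDet u (fun k => ((0 : Fin 1), cols k)) ≠ 0 := by
  classical
  have hxA : ∀ l, x ∉ A l := fun l hx => Finset.notMem_erase x S (hAS l hx)
  have hxC : ∀ l, x ∉ C l := fun l hx => Finset.notMem_erase x S (hCS l hx)
  -- the four index classes
  set R₀ := Finset.univ.filter fun i : Fin r => x ∉ u i with hR₀
  set R₁ := Finset.univ.filter fun i : Fin r => ¬ (x ∉ u i) with hR₁
  set K₀ := Finset.univ.filter fun k : Fin r => x ∉ cols k with hK₀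
  set K₁ := Finset.univ.filter fun k : Fin r => ¬ (x ∉ cols k) with hK₁
  have hr : R₀.card + R₁.card = r := by
    rw [hR₀, hR₁, Finset.card_filter_add_card_filter_not, Finset.card_univ, Fintype.card_fin]
  have hrK : K₀.card + K₁.card = r := by
    rw [hK₀, hK₁, Finset.card_filter_add_card_filter_not, Finset.card_univ, Fintype.card_fin]
  -- counting: rows avoiding `x` = the family one coordinate down; columns avoiding `x` = the ball one coordinate down
  set B' := (S.erase x).powerset.filter fun J => J.card ≤ t with hB'
  set 𝒰' := (B' \ Finset.univ.image A) ∪ Finset.univ.image C with h𝒰'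
  have hmemB' : ∀ J, J ∈ B' ↔ J ⊆ S.erase x ∧ J.card ≤ t := fun J => by simp [hB']
  have hmem𝒰' : ∀ U, U ∈ 𝒰' ↔ ((U ⊆ S.erase x ∧ U.card ≤ t ∧ ∀ l, U ≠ A l) ∨ ∃ l, U = C l) := by
    intro U
    rw [h𝒰', Finset.mem_union, Finset.mem_sdiff, hmemB']
    simp only [Finset.mem_image, Finset.mem_univ, true_and, not_exists, and_assoc]
    constructor
    · rintro (⟨h1, h2, h3⟩ | ⟨l, hl⟩)
      · exact Or.inl ⟨h1, h2, fun l hl => h3 l hl.symm⟩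
      · exact Or.inr ⟨l, hl.symm⟩
    · rintro (⟨h1, h2, h3⟩ | ⟨l, hl⟩)
      · exact Or.inl ⟨h1, h2, fun l hl => h3 l hl.symm⟩
      · exact Or.inr ⟨l, hl.symm⟩
  have hrow_avoid : ∀ U, (∃ i, u i = U ∧ x ∉ u i) ↔ U ∈ 𝒰' := by
    intro U
    rw [hmem𝒰']
    constructor
    · rintro ⟨i, rfl, hxi⟩
      rcases (hU (u i)).1 ⟨i, rfl⟩ with ⟨h1, h2, h3⟩ | ⟨l, hl⟩
      · exact Or.inl ⟨fun a ha => Finset.mem_erase.2 ⟨fun hax => hxi (hax ▸ ha), h1 ha⟩, h2, h3⟩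
      · exact Or.inr ⟨l, hl⟩
    · rintro (⟨h1, h2, h3⟩ | ⟨l, rfl⟩)
      · obtain ⟨i, hi⟩ := (hU U).2 (Or.inl ⟨fun a ha => Finset.mem_of_mem_erase (h1 ha), h2, h3⟩)
        exact ⟨i, hi, fun hx => Finset.notMem_erase x S (h1 (hi ▸ hx))⟩
      · obtain ⟨i, hi⟩ := (hU (C l)).2 (Or.inr ⟨l, rfl⟩)
        exact ⟨i, hi, fun hx => hxC l (hi ▸ hx)⟩
  have hcol_avoid : ∀ J, (∃ k, cols k = J ∧ x ∉ cols k) ↔ J ∈ B' := by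
    intro J
    rw [hmemB']
    constructor
    · rintro ⟨k, rfl, hxk⟩
      obtain ⟨h1, h2⟩ := (hJ (cols k)).1 ⟨k, rfl⟩
      exact ⟨fun a ha => Finset.mem_erase.2 ⟨fun hax => hxk (hax ▸ ha), h1 ha⟩, h2⟩
    · rintro ⟨h1, h2⟩
      obtain ⟨k, hk⟩ := (hJ J).2 ⟨fun a ha => Finset.mem_of_mem_erase (h1 ha), h2⟩
      exact ⟨k, hk, fun hx => Finset.notMem_erase x S (h1 (hk ▸ hx))⟩
  have hR₀img : R₀.image u = 𝒰' := by
    ext U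
    rw [Finset.mem_image, ← hrow_avoid]
    simp [hR₀]
    constructor
    · rintro ⟨i, hxi, rfl⟩; exact ⟨i, rfl, hxi⟩
    · rintro ⟨i, rfl, hxi⟩; exact ⟨i, hxi, rfl⟩
  have hK₀img : K₀.image cols = B' := by
    ext J
    rw [Finset.mem_image, ← hcol_avoid]
    simp [hK₀]
    constructor
    · rintro ⟨k, hxk, rfl⟩; exact ⟨k, rfl, hxk⟩
    · rintro ⟨k, rfl, hxk⟩; exact ⟨k, hxk, rfl⟩
  have hcount : K₀.card = R₀.card := by
    rw [← Finset.card_image_of_injective K₀ hcinj, ← Finset.card_image_of_injective R₀ hu, hR₀img, hK₀img, h𝒰', hB']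
    exact (card_shellFamily t (S.erase x) A C hA hC hAi hCi hAS).symm
  have hcount₁ : K₁.card = R₁.card := by omega
  -- the enumerations
  let f₀ : Fin R₀.card ↪o Fin r := R₀.orderEmbOfFin rfl
  let f₁ : Fin R₁.card ↪o Fin r := R₁.orderEmbOfFin rfl
  let g₀ : Fin R₀.card ↪o Fin r := K₀.orderEmbOfFin hcount
  let g₁ : Fin R₁.card ↪o Fin r := K₁.orderEmbOfFin hcount₁
  have hf₀ : ∀ j, x ∉ u (f₀ j) := fun j => by
    have hm : f₀ j ∈ Finset.univ.filter (fun i : Fin r => x ∉ u i) := Finset.orderEmbOfFin_mem R₀ rfl j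
    exact (Finset.mem_filter.1 hm).2
  have hf₁ : ∀ j, x ∈ u (f₁ j) := fun j => by
    have hm : f₁ j ∈ Finset.univ.filter (fun i : Fin r => ¬ (x ∉ u i)) := Finset.orderEmbOfFin_mem R₁ rfl j
    exact not_not.1 (Finset.mem_filter.1 hm).2
  have hg₀ : ∀ j, x ∉ cols (g₀ j) := fun j => by
    have hm : g₀ j ∈ Finset.univ.filter (fun k : Fin r => x ∉ cols k) := Finset.orderEmbOfFin_mem K₀ hcount j
    exact (Finset.mem_filter.1 hm).2
  have hg₁ : ∀ j, x ∈ cols (g₁ j) := fun j => by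
    have hm : g₁ j ∈ Finset.univ.filter (fun k : Fin r => ¬ (x ∉ cols k)) := Finset.orderEmbOfFin_mem K₁ hcount₁ j
    exact not_not.1 (Finset.mem_filter.1 hm).2
  have hf₀sur : ∀ i, x ∉ u i → ∃ j, f₀ j = i := fun i hi => by
    have : i ∈ Set.range f₀ := by
      rw [show Set.range f₀ = ↑R₀ from Finset.range_orderEmbOfFin R₀ rfl]; simp [hR₀, hi]
    exact this
  have hf₁sur : ∀ i, x ∈ u i → ∃ j, f₁ j = i := fun i hi => by
    have : i ∈ Set.range f₁ := by
      rw [show Set.range f₁ = ↑R₁ from Finset.range_orderEmbOfFin R₁ rfl]; simp [hR₁, hi]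
    exact this
  have hg₀sur : ∀ k, x ∉ cols k → ∃ j, g₀ j = k := fun k hk => by
    have : k ∈ Set.range g₀ := by
      rw [show Set.range g₀ = ↑K₀ from Finset.range_orderEmbOfFin K₀ hcount]; simp [hK₀, hk]
    exact this
  have hg₁sur : ∀ k, x ∈ cols k → ∃ j, g₁ j = k := fun k hk => by
    have : k ∈ Set.range g₁ := by
      rw [show Set.range g₁ = ↑K₁ from Finset.range_orderEmbOfFin K₁ hcount₁]; simp [hK₁, hk]
    exact this
  have hf : Function.Injective (Sum.elim (fun j => f₀ j) (fun j => f₁ j)) := by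
    rintro (j | j) (j' | j') hjj'
    · simp only [Sum.elim_inl] at hjj'; rw [f₀.injective hjj']
    · simp only [Sum.elim_inl, Sum.elim_inr] at hjj'; exact absurd (hjj' ▸ hf₁ j') (hf₀ j)
    · simp only [Sum.elim_inl, Sum.elim_inr] at hjj'; exact absurd (hjj' ▸ hf₁ j) (hf₀ j')
    · simp only [Sum.elim_inr] at hjj'; rw [f₁.injective hjj']
  have hg : Function.Injective (Sum.elim (fun j => g₀ j) (fun j => g₁ j)) := by
    rintro (j | j) (j' | j') hjj'
    · simp only [Sum.elim_inl] at hjj'; rw [g₀.injective hjj']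
    · simp only [Sum.elim_inl, Sum.elim_inr] at hjj'; exact absurd (hjj' ▸ hg₁ j') (hg₀ j)
    · simp only [Sum.elim_inl, Sum.elim_inr] at hjj'; exact absurd (hjj' ▸ hg₁ j) (hg₀ j')
    · simp only [Sum.elim_inr] at hjj'; rw [g₁.injective hjj']
  -- the cut constants: coordinate `x` reads the state `x` only
  let β : Fin 1 → ℂ := fun _ => 0
  let γ : Fin 1 → Fin h → ℂ := fun _ q => if q = x then 1 else 0
  have hxi : ∀ k, xi (fun k => ((0 : Fin 1), cols k)) β γ k = if x ∈ cols k then 1 else 0 := by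
    intro k
    simp only [xi, β, γ, zero_add]
    rw [Finset.sum_ite_eq' (cols k) x]
  refine symGood_of_split_enum u (fun k => ((0 : Fin 1), cols k)) x β γ hr
    (fun j => f₀ j) (fun j => f₁ j) (fun j => g₀ j) (fun j => g₁ j) hf hg hf₀ hf₁
    (fun j => by rw [hxi, if_neg (hg₀ j)]) (fun j => by rw [hxi, if_pos (hg₁ j)]; exact one_ne_zero) ?_ ?_
  · -- the deletion block: the family one coordinate down
    refine IH (fun j => u (f₀ j)) (fun j => cols (g₀ j)) (fun j j' hjj' => f₀.injective (hu hjj'))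
      (fun j j' hjj' => g₀.injective (hcinj hjj')) ?_ ?_
    · intro U
      rw [← hmem𝒰', ← hrow_avoid]
      constructor
      · rintro ⟨j, rfl⟩; exact ⟨f₀ j, rfl, hf₀ j⟩
      · rintro ⟨i, rfl, hxi'⟩
        obtain ⟨j, hj⟩ := hf₀sur i hxi'
        exact ⟨j, by rw [hj]⟩
    · intro J
      rw [← hmemB', ← hcol_avoid]
      constructor
      · rintro ⟨j, rfl⟩; exact ⟨g₀ j, rfl, hg₀ j⟩
      · rintro ⟨k, rfl, hxk⟩
        obtain ⟨j, hj⟩ := hg₀sur k hxk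
        exact ⟨j, by rw [hj]⟩
  · -- the link block: the ball `B_{t-1}(S.erase x)`, zeta leaf
    refine symGood_leaf_erase x (fun j => (u (f₁ j)).erase x) (fun j => cols (g₁ j)) ?_ ?_
    · intro j j' hjj'
      have h1 : u (f₁ j) = u (f₁ j') := by
        rw [← Finset.insert_erase (hf₁ j), ← Finset.insert_erase (hf₁ j')]
        exact congrArg _ hjj'
      exact f₁.injective (hu h1)
    · -- rows through `x` and columns through `x` are the same sets: the ball sets through `x`
      have key : ∀ W : Finset (Fin h), (∃ i, u i = W ∧ x ∈ u i) ↔ (∃ k, cols k = W ∧ x ∈ cols k) := by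
        intro W
        constructor
        · rintro ⟨i, rfl, hxi'⟩
          rcases (hU (u i)).1 ⟨i, rfl⟩ with ⟨h1, h2, -⟩ | ⟨l, hl⟩
          · obtain ⟨k, hk⟩ := (hJ (u i)).2 ⟨h1, h2⟩
            exact ⟨k, hk, hk ▸ hxi'⟩
          · exact absurd (hl ▸ hxi') (hxC l)
        · rintro ⟨k, rfl, hxk⟩
          obtain ⟨h1, h2⟩ := (hJ (cols k)).1 ⟨k, rfl⟩
          obtain ⟨i, hi⟩ := (hU (cols k)).2 (Or.inl ⟨h1, h2, fun l hl => hxA l (hl ▸ hxk)⟩)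
          exact ⟨i, hi, hi ▸ hxk⟩
      intro U
      constructor
      · rintro ⟨j, rfl⟩
        obtain ⟨k, hk, hxk⟩ := (key (u (f₁ j))).1 ⟨f₁ j, rfl, hf₁ j⟩
        obtain ⟨j', hj'⟩ := hg₁sur k hxk
        exact ⟨j', by rw [hj', hk]⟩
      · rintro ⟨j, rfl⟩
        obtain ⟨i, hi, hxi'⟩ := (key (cols (g₁ j))).2 ⟨g₁ j, rfl, hg₁ j⟩
        obtain ⟨j', hj'⟩ := hf₁sur i hxi'
        exact ⟨j', by rw [hj', hi]⟩

/-! ## 2. All free coordinates at once -/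

/-- **Free coordinates, iterated.**  If the m-th-shell family of `(A, C)` is served on a coordinate set `S₀ ⊇ supp(A, C)` (every bijective
enumeration generically good), it is served on every `S ⊇ S₀`. -/
theorem served_of_subset_free (t : ℕ) {m : ℕ} (A C : Fin m → Finset (Fin h))
    (hA : ∀ l, (A l).card = t) (hC : ∀ l, (C l).card = t + 1)
    (hAi : Function.Injective A) (hCi : Function.Injective C)
    (S₀ : Finset (Fin h)) (hAS : ∀ l, A l ⊆ S₀) (hCS : ∀ l, C l ⊆ S₀)
    (H : ∀ ⦃r : ℕ⦄ (u cols : Fin r → Finset (Fin h)), Function.Injective u → Function.Injective cols →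
      (∀ U, (∃ i, u i = U) ↔ ((U ⊆ S₀ ∧ U.card ≤ t ∧ ∀ l, U ≠ A l) ∨ ∃ l, U = C l)) →
      (∀ J, (∃ k, cols k = J) ↔ (J ⊆ S₀ ∧ J.card ≤ t)) →
      symDet u (fun k => ((0 : Fin 1), cols k)) ≠ 0)
    (S : Finset (Fin h)) (hS : S₀ ⊆ S)
    {r : ℕ} (u cols : Fin r → Finset (Fin h)) (hu : Function.Injective u) (hcinj : Function.Injective cols)
    (hU : ∀ U, (∃ i, u i = U) ↔ ((U ⊆ S ∧ U.card ≤ t ∧ ∀ l, U ≠ A l) ∨ ∃ l, U = C l))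
    (hJ : ∀ J, (∃ k, cols k = J) ↔ (J ⊆ S ∧ J.card ≤ t)) :
    symDet u (fun k => ((0 : Fin 1), cols k)) ≠ 0 := by
  classical
  -- induction on the number of free coordinates `|S \ S₀|`
  suffices main : ∀ (n : ℕ) (S : Finset (Fin h)), S₀ ⊆ S → (S \ S₀).card = n →
      ∀ ⦃r : ℕ⦄ (u cols : Fin r → Finset (Fin h)), Function.Injective u → Function.Injective cols →
        (∀ U, (∃ i, u i = U) ↔ ((U ⊆ S ∧ U.card ≤ t ∧ ∀ l, U ≠ A l) ∨ ∃ l, U = C l)) →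
        (∀ J, (∃ k, cols k = J) ↔ (J ⊆ S ∧ J.card ≤ t)) →
        symDet u (fun k => ((0 : Fin 1), cols k)) ≠ 0 from
    main _ S hS rfl u cols hu hcinj hU hJ
  intro n
  induction n with
  | zero =>
    intro S hS hcard
    have hSS : S = S₀ := by
      have := Finset.sdiff_eq_empty_iff_subset.1 (Finset.card_eq_zero.1 hcard)
      exact le_antisymm this hS
    subst hSS
    exact H
  | succ n ih =>
    intro S hS hcard r u cols hu hcinj hU hJ
    obtain ⟨x, hx⟩ : (S \ S₀).Nonempty := by
      rw [← Finset.card_pos, hcard]; exact Nat.succ_pos n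
    rw [Finset.mem_sdiff] at hx
    have hS' : S₀ ⊆ S.erase x := fun a ha => Finset.mem_erase.2 ⟨fun hax => hx.2 (hax ▸ ha), hS ha⟩
    have hcard' : (S.erase x \ S₀).card = n := by
      rw [Finset.erase_sdiff_comm, Finset.card_erase_of_mem (Finset.mem_sdiff.2 hx), hcard]; rfl
    exact served_of_erase_free t A C hA hC hAi hCi S x (fun l => (hAS l).trans hS') (fun l => (hCS l).trans hS')
      (ih (S.erase x) hS' hcard') u cols hu hcinj hU hJ

/-! ## 3. Transfer along an embedding of coordinates (and states) -/

/-- **Embedding transfer.**  The standard statement «every admissible `(u, cols)` on `Fin n` has a table» for `(A, C)` gives: every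
bijective enumeration of the family of `(A.map σ, C.map σ)` on the coordinate set `σ(Fin n) ⊆ Fin h`, against the ball of that set, is
generically good. -/
theorem served_image_of_served (n t : ℕ) {m : ℕ} (σ : Fin n ↪ Fin h) (A C : Fin m → Finset (Fin n))
    (H : ∀ ⦃r : ℕ⦄ (u cols : Fin r → Finset (Fin n)), Function.Injective u →
      (∀ i, ((u i).card ≤ t ∧ ∀ l, u i ≠ A l) ∨ ∃ l, u i = C l) →
      (∀ J : Finset (Fin n), J.card ≤ t → ∃ k, cols k = J) →
      ∃ tx : Option (Fin n) → Fin n → ℂ,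
        (Matrix.of fun i k : Fin r => ∏ a ∈ u i, (tx none a + ∑ q ∈ cols k, tx (some q) a)).det ≠ 0)
    {r : ℕ} (u cols : Fin r → Finset (Fin h)) (hu : Function.Injective u)
    (hU : ∀ U, (∃ i, u i = U) ↔
      ((U ⊆ Finset.univ.map σ ∧ U.card ≤ t ∧ ∀ l, U ≠ (A l).map σ) ∨ ∃ l, U = (C l).map σ))
    (hJ : ∀ J, (∃ k, cols k = J) ↔ (J ⊆ Finset.univ.map σ ∧ J.card ≤ t)) :
    symDet u (fun k => ((0 : Fin 1), cols k)) ≠ 0 := by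
  classical
  -- every row and column lies inside the image of `σ`
  have hUsub : ∀ i, u i ⊆ Finset.univ.map σ := by
    intro i
    rcases (hU (u i)).1 ⟨i, rfl⟩ with ⟨h1, -, -⟩ | ⟨l, hl⟩
    · exact h1
    · rw [hl]; exact Finset.map_subset_map.2 (Finset.subset_univ _)
  have hJsub : ∀ k, cols k ⊆ Finset.univ.map σ := fun k => ((hJ (cols k)).1 ⟨k, rfl⟩).1
  -- pull back along `σ`
  have hinjOn : ∀ s : Finset (Fin h), Set.InjOn σ (σ ⁻¹' ↑s) := fun s => σ.injective.injOn
  let u' : Fin r → Finset (Fin n) := fun i => (u i).preimage σ (hinjOn _)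
  let cols' : Fin r → Finset (Fin n) := fun k => (cols k).preimage σ (hinjOn _)
  have hmap : ∀ s : Finset (Fin h), s ⊆ Finset.univ.map σ → (s.preimage σ (hinjOn s)).map σ = s := by
    intro s hs
    ext a
    rw [Finset.mem_map]
    constructor
    · rintro ⟨b, hb, rfl⟩; exact Finset.mem_preimage.1 hb
    · intro ha
      obtain ⟨b, -, rfl⟩ := Finset.mem_map.1 (hs ha)
      exact ⟨b, Finset.mem_preimage.2 ha, rfl⟩
  have hu' : ∀ i, (u' i).map σ = u i := fun i => hmap (u i) (hUsub i)
  have hcols' : ∀ k, (cols' k).map σ = cols k := fun k => hmap (cols k) (hJsub k)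
  have hpre : ∀ s : Finset (Fin n), (s.map σ).preimage σ (hinjOn _) = s := by
    intro s; ext b; simp
  -- the standard hypotheses for the pulled-back configuration
  have hu'inj : Function.Injective u' := by
    intro i j hij
    apply hu
    rw [← hu' i, ← hu' j]
    exact congrArg _ hij
  have hU' : ∀ i, ((u' i).card ≤ t ∧ ∀ l, u' i ≠ A l) ∨ ∃ l, u' i = C l := by
    intro i
    rcases (hU (u i)).1 ⟨i, rfl⟩ with ⟨-, h2, h3⟩ | ⟨l, hl⟩
    · refine Or.inl ⟨?_, fun l hl => h3 l ?_⟩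
      · rw [← hu' i, Finset.card_map] at h2; exact h2
      · rw [← hu' i, hl]
    · refine Or.inr ⟨l, ?_⟩
      show (u i).preimage σ (hinjOn _) = C l
      simp_rw [hl]; exact hpre (C l)
  have hJ' : ∀ J : Finset (Fin n), J.card ≤ t → ∃ k, cols' k = J := by
    intro J hJc
    obtain ⟨k, hk⟩ := (hJ (J.map σ)).2 ⟨Finset.map_subset_map.2 (Finset.subset_univ _), by rwa [Finset.card_map]⟩
    refine ⟨k, ?_⟩
    show (cols k).preimage σ (hinjOn _) = J
    simp_rw [hk]; exact hpre J
  obtain ⟨tx, htx⟩ := H u' cols' hu'inj hU' hJ'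
  have hG : symDet u' (fun k => ((0 : Fin 1), cols' k)) ≠ 0 := (exists_table_iff_symGood u' cols').1 ⟨tx, htx⟩
  -- rename coordinates, then states
  have hG₁ := symGood_map_embedding σ u' (fun k => ((0 : Fin 1), cols' k)) hG
  have hG₂ := symGood_map_stateEmbedding σ (fun i => (u' i).map σ) (fun k => ((0 : Fin 1), cols' k)) hG₁
  simp only [hu', hcols'] at hG₂
  exact hG₂

/-! ## 4. ★ The free-coordinate theorem -/

/-- ★ **THE FREE-COORDINATE THEOREM.**  If the m-swap family `(A, C)` (`|A_l| = t`, `|C_l| = t + 1`, both injective) is served on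
`Fin n` — every injective row family in `B_t(n) ∖ {A_l} ∪ {C_l}` with columns covering `B_t(n)` has a table — then for every embedding
`σ : Fin n ↪ Fin h` the family `(A.map σ, C.map σ)` is served on `Fin h`.  (Every «class for all h» is its instance at `h = |support|`.) -/
theorem exists_table_multiSwap_map_embedding (n t : ℕ) {m : ℕ} (σ : Fin n ↪ Fin h) (A C : Fin m → Finset (Fin n))
    (hA : ∀ l, (A l).card = t) (hC : ∀ l, (C l).card = t + 1)
    (hAi : Function.Injective A) (hCi : Function.Injective C)
    (H : ∀ ⦃r : ℕ⦄ (u cols : Fin r → Finset (Fin n)), Function.Injective u →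
      (∀ i, ((u i).card ≤ t ∧ ∀ l, u i ≠ A l) ∨ ∃ l, u i = C l) →
      (∀ J : Finset (Fin n), J.card ≤ t → ∃ k, cols k = J) →
      ∃ tx : Option (Fin n) → Fin n → ℂ,
        (Matrix.of fun i k : Fin r => ∏ a ∈ u i, (tx none a + ∑ q ∈ cols k, tx (some q) a)).det ≠ 0)
    {r : ℕ} (u cols : Fin r → Finset (Fin h)) (hu : Function.Injective u)
    (hU : ∀ i, ((u i).card ≤ t ∧ ∀ l, u i ≠ (A l).map σ) ∨ ∃ l, u i = (C l).map σ)
    (hcols : ∀ J : Finset (Fin h), J.card ≤ t → ∃ k, cols k = J) :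
    ∃ tx : Option (Fin h) → Fin h → ℂ,
      (Matrix.of fun i k : Fin r => ∏ a ∈ u i, (tx none a + ∑ q ∈ cols k, tx (some q) a)).det ≠ 0 := by
  classical
  have hA' : ∀ l, ((A l).map σ).card = t := fun l => by rw [Finset.card_map, hA]
  have hC' : ∀ l, ((C l).map σ).card = t + 1 := fun l => by rw [Finset.card_map, hC]
  have hAi' : Function.Injective fun l => (A l).map σ := fun l l' hll' => hAi (Finset.map_injective σ hll')
  have hCi' : Function.Injective fun l => (C l).map σ := fun l l' hll' => hCi (Finset.map_injective σ hll')
  obtain ⟨hcinj, hUr, hJr⟩ := rigidity t (fun l => (A l).map σ) (fun l => (C l).map σ) hA' hC' hAi' hCi' u cols hu hU hcols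
  rw [exists_table_iff_symGood]
  refine served_of_subset_free t (fun l => (A l).map σ) (fun l => (C l).map σ) hA' hC' hAi' hCi'
    (Finset.univ.map σ) (fun l => Finset.map_subset_map.2 (Finset.subset_univ _))
    (fun l => Finset.map_subset_map.2 (Finset.subset_univ _))
    (fun r u cols hu _ hU hJ => served_image_of_served n t σ A C H u cols hu hU hJ)
    Finset.univ (Finset.subset_univ _) u cols hu hcinj ?_ ?_
  · intro U; rw [hUr U]; simp
  · intro J; rw [hJr J]; simp

end BallCut

end

end Summit.ValiantsHypothesis.ValiantsHypothesis.Theorems.BarrierLever.HiddenStates
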